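import Summits.BirchSwinnertonDyer.BirchSwinnertonDyer.Theorems.SchneiderFreeAdditiveX3PoitouTateSelmerComplementReduction
import Summits.BirchSwinnertonDyer.Rank1Residual.GaloisImage.UnramifiedOrthogonalOfIsPerfect
import Literature.NumberTheory.GaloisCohomology.PoitouTateNumberField
import HarnessLib

/-!
# Poitou–Tate toolkit (3/3): `SelmerComplement` from the basic middle exactness, and the named fact
# `poitouTate_selmerStructure_duality` from `SelmerComplement` of THE invariant maps

Seat `bsd-schneider-door-c6`, gen 5 (cell `bsd-schneider-ideate`; crux `AnticycControlAdditiveK`,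
stmt-BirchSwinnertonDyer-19295).  THEOREMS ONLY (no definition, no named fact, no `sorry`).  HONEST
FRAMING: proves NO case of Poitou–Tate duality and no case of BSD; it isolates the one unproved ingredient
of `poitouTate_selmerStructure_duality K` (`IsPerfect ∧ SumLocalTermEqZero ∧ UnramifiedOrthogonal ∧
SelmerComplement` for one family at every level `n`), on which the registered stubs `stub_baseCountTors` /
`stub_ptSurj` / `stub_coinv` of crux 19295 — and every other consumer of the fact — depend.

* **`selmerComplement_of_middleExact`** — for a family `inv` with `IsPerfect`, `InjectiveAtRealPlaces`,
  `UnramifiedOrthogonal`: the two basic middle-exactness statements `hE` (for `M`) and `hE'` (for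
  `M^D`, `M` on the left), for all finite `n`-torsion `M` and all admissible `S`, imply
  `inv.SelmerComplement` (files 1/3, 2/3).
* For THE invariant maps of a number field `K : Type` (`LocalInvariants.canonical K n`; tree theorems
  `canonical_isPerfect`, `canonical_injectiveAtRealPlaces`, `sumInvLocalizationEqZero_canonical_of_numberField`,
  and at prime-power `n` n1011's `UnramifiedCup.unramifiedOrthogonal_of_isPerfect` = Milne I Thm. 2.6):
  `sumLocalTermEqZero_canonical`; **`poitouTate_selmerStructure_duality_of_canonical`** (the named fact ⟸
  `UnramifiedOrthogonal` and `SelmerComplement` of `canonical K n` for all `n`);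
  **`exists_localInvariants_duality_of_selmerComplement_canonical`** (at a PRIME-POWER level, the
  four-property family that consumers destructure ⟸ `SelmerComplement` of `canonical K n` alone);
  **`selmerComplement_canonical_of_middleExact`** (at a prime-power level, that `SelmerComplement` ⟸ the
  two basic middle-exactness statements alone).

So at prime-power level what separates the tree from `poitouTate_selmerStructure_duality` is EXACTLY
Milne I Thm. 4.10(b) `Ker γ¹ ⊆ Im β¹` for THE invariant maps (for `M`, and for `M^D` in the
`M`-on-the-left spelling) — the class-formation / Tate–Nakayama half of Tate's theorem; no
Selmer-structure bookkeeping, no local and no archimedean statement remains.  TODO(general form):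
composite `n` needs Milne I Thm. 2.6 for all `n` (n1011's TODO); nothing else here uses primality.

References: [Howard2004HeegnerKolyvagin] Thm. 2.1.11 (arXiv:1202.6340 p. 6); [MilneADT2006] I Cor. 2.3,
Thm. 2.6, Thm. 4.10 (b); [Rubin2000] Thm. 1.7.3; [CasselsFrohlichANT1967] Ch. VII §11.
-/

noncomputable section

open Function NumberField IsDedekindDomain
open scoped NumberField

universe u

set_option linter.dupNamespace false

namespace Summit.BirchSwinnertonDyer.BirchSwinnertonDyer.Theorems.SchneiderFreeAdditiveX3.PoitouTateReduction

open Summit.BirchSwinnertonDyer.Rank1Residual.X11b.FiniteDuality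

section Assembly

open Field
open Literature.NumberTheory.GaloisRepresentations Literature.NumberTheory.GaloisCohomology
open Literature.NumberTheory.GaloisRepresentations.DiscreteGaloisModule (mu localTatePairingZMod
  tateDual SelmerStructure unramifiedSubgroup)

variable {K : Type u} [Field K] [NumberField K] {n : ℕ} [NeZero n]

/-- **Poitou–Tate duality for Selmer structures (Howard 2004 Thm. 2.1.11, both inclusions
"annihilator ⊆ image", all pairs `𝓕 ≤ 𝓖`) — the conjunct `SelmerComplement` of the tree's named fact
`poitouTate_selmerStructure_duality` — REDUCED to Milne's basic middle exactness `Ker γ¹ ⊆ Im β¹`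
(*ADT* I Thm. 4.10(b), `r = 1`) for a family of local invariant maps that is a local Tate duality at
the finite places (`IsPerfect`), injective at the real places (`InjectiveAtRealPlaces`) and satisfies
Milne I Thm. 2.6 (`UnramifiedOrthogonal`).**  The two hypotheses `hE`, `hE'` are the printed statement
"`Im(H¹(G_S, M) → ⊕_{v∈S} H¹(K_v, M)) = Ker(⊕_{v∈S} H¹(K_v, M) → H¹(G_S, M^D)^*)`" (finite `S` containing
the infinite places, the places above `n` and the ramified places of `M`; `H¹(G_S, ·)` = classes
unramified outside `S`) for `M` and, dually, for `M^D` read through `M^{DD} = M`.  For the pinned family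
`LocalInvariants.canonical` the first three properties are tree theorems at prime-power level
(`canonical_isPerfect`, `canonical_injectiveAtRealPlaces`, `UnramifiedCup.unramifiedOrthogonal_of_isPerfect`),
so this isolates the one unproved ingredient of the fact.
[cite: Howard2004HeegnerKolyvagin, Thm. 2.1.11 (arXiv:1202.6340 p. 6)] [cite: MilneADT2006, Ch. I, Thm. 4.10(b)]
[cite: Rubin2000, Thm. 1.7.3] -/
theorem selmerComplement_of_middleExact (inv : LocalInvariants K n) (hperf : inv.IsPerfect)
    (hreal : inv.InjectiveAtRealPlaces) (hUO : inv.UnramifiedOrthogonal)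
    (hE : ∀ ⦃M : Type u⦄ [AddCommGroup M] [TopologicalSpace M] [DiscreteTopology M] [Finite M]
      (ρ : DiscreteGaloisModule K M), (∀ m : M, n • m = 0) →
      ∀ S : Finset (Place K), (∀ w : InfinitePlace K, (Sum.inl w : Place K) ∈ S) →
        (∀ v : HeightOneSpectrum (𝓞 K), (Sum.inr v : Place K) ∉ S →
          ((n : ℕ) : 𝓞 K) ∉ v.asIdeal ∧ GaloisRep.IsUnramifiedAt v ρ) →
        ∀ t : Π v : Place K, galoisCohomology (ρ.toLocal v) 1,
          (∀ y : galoisCohomology (ρ.tateDual n) 1,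
            (∀ v : HeightOneSpectrum (𝓞 K), (Sum.inr v : Place K) ∉ S →
              galoisCohomology.localization (ρ.tateDual n) (Sum.inr v) 1 y ∈
                unramifiedSubgroup (GaloisRep.toLocal v (ρ.tateDual n)) 1) →
            ∑ v ∈ S, localTatePairingZMod ρ n v (inv v) (t v)
              (galoisCohomology.localization (ρ.tateDual n) v 1 y) = 0) →
          ∃ x : galoisCohomology ρ 1,
            (∀ v : HeightOneSpectrum (𝓞 K), (Sum.inr v : Place K) ∉ S →
              galoisCohomology.localization ρ (Sum.inr v) 1 x ∈
                unramifiedSubgroup (GaloisRep.toLocal v ρ) 1) ∧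
            ∀ v ∈ S, galoisCohomology.localization ρ v 1 x = t v)
    (hE' : ∀ ⦃M : Type u⦄ [AddCommGroup M] [TopologicalSpace M] [DiscreteTopology M] [Finite M]
      (ρ : DiscreteGaloisModule K M), (∀ m : M, n • m = 0) →
      ∀ S : Finset (Place K), (∀ w : InfinitePlace K, (Sum.inl w : Place K) ∈ S) →
        (∀ v : HeightOneSpectrum (𝓞 K), (Sum.inr v : Place K) ∉ S →
          ((n : ℕ) : 𝓞 K) ∉ v.asIdeal ∧ GaloisRep.IsUnramifiedAt v ρ) →
        ∀ u : Π v : Place K, galoisCohomology ((ρ.tateDual n).toLocal v) 1,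
          (∀ x : galoisCohomology ρ 1,
            (∀ v : HeightOneSpectrum (𝓞 K), (Sum.inr v : Place K) ∉ S →
              galoisCohomology.localization ρ (Sum.inr v) 1 x ∈
                unramifiedSubgroup (GaloisRep.toLocal v ρ) 1) →
            ∑ v ∈ S, localTatePairingZMod ρ n v (inv v)
              (galoisCohomology.localization ρ v 1 x) (u v) = 0) →
          ∃ y : galoisCohomology (ρ.tateDual n) 1,
            (∀ v : HeightOneSpectrum (𝓞 K), (Sum.inr v : Place K) ∉ S →
              galoisCohomology.localization (ρ.tateDual n) (Sum.inr v) 1 y ∈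
                unramifiedSubgroup (GaloisRep.toLocal v (ρ.tateDual n)) 1) ∧
            ∀ v ∈ S, galoisCohomology.localization (ρ.tateDual n) v 1 y = u v) :
    inv.SelmerComplement := by
  intro M _ _ _ _ ρ hM S hS 𝓕 𝓖 hle h𝓕 h𝓖
  exact ⟨fun t ht horth => exists_selmer_sub_mem_of_middleExact inv hperf hreal hUO ρ hM hS
      (hE ρ hM S h𝓕.1 hS) hle h𝓕 h𝓖 t ht horth,
    fun u hu horth => exists_dualSelmer_sub_mem_of_middleExact inv hperf hreal hUO ρ hM hS
      (hE' ρ hM S h𝓕.1 hS) hle h𝓕 h𝓖 u hu horth⟩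

end Assembly

/-! ## §4. The named fact, and its prime-power levels, from `SelmerComplement` of THE invariant maps -/

section Canonical

open Field
open Literature.NumberTheory.GaloisRepresentations Literature.NumberTheory.GaloisCohomology

variable {K : Type} [Field K] [NumberField K]

/-- `SumLocalTermEqZero` for the canonical family at every level (the tree's reciprocity law
`sumInvLocalizationEqZero_canonical_of_numberField`, Tate / Cassels–Fröhlich VII §11, in cup-product
form). [cite: CasselsFrohlichANT1967, Ch. VII §11] [cite: MilneADT2006, Ch. I, Thm. 4.10(b)] -/
theorem sumLocalTermEqZero_canonical (n : ℕ) [NeZero n] :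
    (LocalInvariants.canonical K n).SumLocalTermEqZero :=
  (LocalInvariants.canonical K n).sumLocalTermEqZero_of_sumInvLocalizationEqZero
    (sumInvLocalizationEqZero_canonical_of_numberField K n)

/-- **`poitouTate_selmerStructure_duality K` ⟸ Milne I Thm. 2.6 and Howard Thm. 2.1.11 for THE
invariant maps.**  For a number field `K : Type`: if at every level `n ≥ 1` the canonical family
`LocalInvariants.canonical K n` satisfies `UnramifiedOrthogonal` (a tree theorem at prime-power `n`,
`UnramifiedCup.unramifiedOrthogonal_of_isPerfect`) and `SelmerComplement` (⟸ the basic middle exactness,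
`selmerComplement_of_middleExact`), the four-conjunct named fact holds — `IsPerfect`
(`canonical_isPerfect`) and `SumLocalTermEqZero` (`sumLocalTermEqZero_canonical`) being tree theorems.
[cite: MilneADT2006, Ch. I, Thm. 4.10(b), Thm. 2.6, Cor. 2.3] [cite: Howard2004HeegnerKolyvagin, Thm. 2.1.11 (arXiv:1202.6340 p. 6)] -/
theorem poitouTate_selmerStructure_duality_of_canonical
    (hUO : ∀ (n : ℕ) [NeZero n], (LocalInvariants.canonical K n).UnramifiedOrthogonal)
    (hSC : ∀ (n : ℕ) [NeZero n], (LocalInvariants.canonical K n).SelmerComplement) :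
    poitouTate_selmerStructure_duality K := fun n _ =>
  ⟨LocalInvariants.canonical K n, LocalInvariants.canonical_isPerfect, sumLocalTermEqZero_canonical n,
    hUO n, hSC n⟩

/-- **The named fact at a PRIME-POWER level from `SelmerComplement` of the canonical family alone**:
for `n = p^k ≥ 2`... more precisely for every prime power `n`, if `LocalInvariants.canonical K n` has
`SelmerComplement` then there is a family with all four properties of
`poitouTate_selmerStructure_duality K` at level `n` (what every consumer destructures), the other three
being tree theorems (`canonical_isPerfect`, `sumLocalTermEqZero_canonical`,
`UnramifiedCup.unramifiedOrthogonal_of_isPerfect`).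
[cite: MilneADT2006, Ch. I, Thm. 4.10(b), Thm. 2.6, Cor. 2.3] [cite: Howard2004HeegnerKolyvagin, Thm. 2.1.11 (arXiv:1202.6340 p. 6)] -/
theorem exists_localInvariants_duality_of_selmerComplement_canonical (n : ℕ) [NeZero n]
    (hn : IsPrimePow n) (hSC : (LocalInvariants.canonical K n).SelmerComplement) :
    ∃ inv : LocalInvariants K n,
      inv.IsPerfect ∧ inv.SumLocalTermEqZero ∧ inv.UnramifiedOrthogonal ∧ inv.SelmerComplement :=
  ⟨LocalInvariants.canonical K n, LocalInvariants.canonical_isPerfect, sumLocalTermEqZero_canonical n,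
    Summit.BirchSwinnertonDyer.Rank1Residual.GaloisImage.UnramifiedCup.unramifiedOrthogonal_of_isPerfect
      _ hn LocalInvariants.canonical_isPerfect, hSC⟩

/-- **`SelmerComplement` of the canonical family at a prime-power level from the basic middle
exactness alone** (`selmerComplement_of_middleExact` with `canonical_isPerfect`,
`canonical_injectiveAtRealPlaces` and `UnramifiedCup.unramifiedOrthogonal_of_isPerfect`): at prime-power
`n` the ENTIRE content of `poitouTate_selmerStructure_duality` beyond tree theorems is Milne I
Thm. 4.10(b) `Ker γ¹ ⊆ Im β¹` for THE invariant maps (for `M` and for `M^D`).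
[cite: MilneADT2006, Ch. I, Thm. 4.10(b)] [cite: Howard2004HeegnerKolyvagin, Thm. 2.1.11 (arXiv:1202.6340 p. 6)] -/
theorem selmerComplement_canonical_of_middleExact (n : ℕ) [NeZero n] (hn : IsPrimePow n)
    (hE : ∀ ⦃M : Type⦄ [AddCommGroup M] [TopologicalSpace M] [DiscreteTopology M] [Finite M]
      (ρ : DiscreteGaloisModule K M), (∀ m : M, n • m = 0) →
      ∀ S : Finset (Place K), (∀ w : InfinitePlace K, (Sum.inl w : Place K) ∈ S) →
        (∀ v : HeightOneSpectrum (𝓞 K), (Sum.inr v : Place K) ∉ S →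
          ((n : ℕ) : 𝓞 K) ∉ v.asIdeal ∧ GaloisRep.IsUnramifiedAt v ρ) →
        ∀ t : Π v : Place K, galoisCohomology (ρ.toLocal v) 1,
          (∀ y : galoisCohomology (ρ.tateDual n) 1,
            (∀ v : HeightOneSpectrum (𝓞 K), (Sum.inr v : Place K) ∉ S →
              galoisCohomology.localization (ρ.tateDual n) (Sum.inr v) 1 y ∈
                DiscreteGaloisModule.unramifiedSubgroup (GaloisRep.toLocal v (ρ.tateDual n)) 1) →
            ∑ v ∈ S, DiscreteGaloisModule.localTatePairingZMod ρ n v (LocalInvariants.canonical K n v) (t v)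
              (galoisCohomology.localization (ρ.tateDual n) v 1 y) = 0) →
          ∃ x : galoisCohomology ρ 1,
            (∀ v : HeightOneSpectrum (𝓞 K), (Sum.inr v : Place K) ∉ S →
              galoisCohomology.localization ρ (Sum.inr v) 1 x ∈
                DiscreteGaloisModule.unramifiedSubgroup (GaloisRep.toLocal v ρ) 1) ∧
            ∀ v ∈ S, galoisCohomology.localization ρ v 1 x = t v)
    (hE' : ∀ ⦃M : Type⦄ [AddCommGroup M] [TopologicalSpace M] [DiscreteTopology M] [Finite M]
      (ρ : DiscreteGaloisModule K M), (∀ m : M, n • m = 0) →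
      ∀ S : Finset (Place K), (∀ w : InfinitePlace K, (Sum.inl w : Place K) ∈ S) →
        (∀ v : HeightOneSpectrum (𝓞 K), (Sum.inr v : Place K) ∉ S →
          ((n : ℕ) : 𝓞 K) ∉ v.asIdeal ∧ GaloisRep.IsUnramifiedAt v ρ) →
        ∀ u : Π v : Place K, galoisCohomology ((ρ.tateDual n).toLocal v) 1,
          (∀ x : galoisCohomology ρ 1,
            (∀ v : HeightOneSpectrum (𝓞 K), (Sum.inr v : Place K) ∉ S →
              galoisCohomology.localization ρ (Sum.inr v) 1 x ∈
                DiscreteGaloisModule.unramifiedSubgroup (GaloisRep.toLocal v ρ) 1) →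
            ∑ v ∈ S, DiscreteGaloisModule.localTatePairingZMod ρ n v (LocalInvariants.canonical K n v)
              (galoisCohomology.localization ρ v 1 x) (u v) = 0) →
          ∃ y : galoisCohomology (ρ.tateDual n) 1,
            (∀ v : HeightOneSpectrum (𝓞 K), (Sum.inr v : Place K) ∉ S →
              galoisCohomology.localization (ρ.tateDual n) (Sum.inr v) 1 y ∈
                DiscreteGaloisModule.unramifiedSubgroup (GaloisRep.toLocal v (ρ.tateDual n)) 1) ∧
            ∀ v ∈ S, galoisCohomology.localization (ρ.tateDual n) v 1 y = u v) :
    (LocalInvariants.canonical K n).SelmerComplement :=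
  selmerComplement_of_middleExact _ LocalInvariants.canonical_isPerfect
    LocalInvariants.canonical_injectiveAtRealPlaces
    (Summit.BirchSwinnertonDyer.Rank1Residual.GaloisImage.UnramifiedCup.unramifiedOrthogonal_of_isPerfect
      _ hn LocalInvariants.canonical_isPerfect) hE hE'

end Canonical

end Summit.BirchSwinnertonDyer.BirchSwinnertonDyer.Theorems.SchneiderFreeAdditiveX3.PoitouTateReduction

end
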